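import Literature.IUT.LogThetaLattice.BiCoresOfKits
import Literature.IUT.LogThetaLattice.PacketLogVolumesProofs2
import HarnessLib

/-!
# [IUTchIII] Prop 3.9 (ii) at the STRIP LEVEL: `Prop39ii_monoAnalyticCompat` for the poly-isomorphisms of
# log-shells of §1 (`BiCoricData.monoFxm`, `monoHolAt`, `monoShellOfDeltaAt`, …) through a set-level reading of
# the log-shell category — the junction «R-ii-strip» of plan/L6/SUBDAG-IUTchIII-Prop-39.md (proof-only)

S. Mochizuki, *Inter-universal Teichmüller theory III*, kurims manuscript (May 2020), Proposition 3.9 (ii)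
"(Mono-analytic Compatibility)" p. 116: "… one obtains [by a slight abuse of notation] log-volumes … which are
compatible with the log-volumes obtained in (i), relative to the natural poly-isomorphisms of Proposition 3.2,
(i). In particular, these log-volumes may be constructed via a functorial algorithm from the `𝒟^⊢`-prime-strips
under consideration. … a similar theory … for … "`𝓘_{†𝓕^{⊢×μ}_v}`" … compatible with the theory obtained for
"`𝒟^⊢`" relative to the various natural poly-isomorphisms" (the bracket "[by a slight abuse of notation]" is
print's own, p. 116 l. 38–39 of the kurims render; doc-only v2 restoring it, referee flag O12-F22);
Proposition 1.2 (vi) p. 32 / (viii) p. 33: the `Ism`-orbit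
`log(†𝒟^⊢_v) ⥲ log(†𝓕^{⊢×μ}_v)` and the isomorphisms `log(†𝒟^⊢_v) ⥲ log(†𝓕^{⊢×μ}_v) ⥲ log(†𝓕_v)` are "compatible
with one another, … the respective log-shells, and the respective log-volumes"; [AbsTopIII] Prop 5.8 (iv)–(vi)
(log-volumes on mono-analytic log-shells are determined by the topological module structure)
[claim: Mochizuki2012, status: disputed]. abc-iut cell, layer L6, seat abc-iut-w4-d005 (gen 3); row GO'd by
abc-iut-L6-lead §F v1.19k (2b), first reader abc-iut-L6-d3. PROOF-ONLY: no `def`, no new named fact, no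
hypothesis structure; claim key DISPUTED (D-0012); nothing here takes a side on [IUTchIII] Cor. 3.12.

## The junction

abc-iut-L6-t4 typed Prop 3.9 (ii) as `Prop39ii_monoAnalyticCompat poly μD μF := ∀ e ∈ poly, ∀ S, μD S = μF (e '' S)`
over a SET of bijections `poly : Set (XD ≃ XF)` between two carriers and two log-volumes (`PacketLogVolumes.lean`,
p404053); it is DISCHARGED in the tree at every model the cell works with (place by place: abc-iut-L6-d3
`prop39ii_monoAnalyticCompat_localField` / `_arch`; two containers with integral structures:
`prop39ii_monoAnalyticCompat_integralStructure`, `PacketLogVolumesProofs2.lean`; one tensor packet: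
abc-iut-w5-d178 `prop39ii_monoAnalyticCompat_tensorPacket`; the genuine `A`-packets: abc-iut-L6-d3
`prop39ii_monoAnalyticCompat_capsulePacket`, p420920). abc-iut-L6-t3 typed the printed "natural
poly-isomorphisms" of log-shells at the STRIP level, as sets of isomorphisms in the ABSTRACT log-shell category
`B.Sh` of a `B : BiCoricData S` (`BiCores.lean` p406839: `monoFxm` = the `Ism`-orbit of Prop 1.2 (vi)/(vii),
`monoFxmOfF ⊆ monoFxm`, `fxmHol`, `monoHolAt`/`monoHolAt'` = Prop 1.2 (viii), `coricIsoAt` = (ix),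
`monoShellOfDeltaAt`/`shellKummerAt`/`biCoricShellPolyIso` = Thm 1.5 (iv)); SUBDAG-IUTchIII-Prop-39 recorded the
residual «R-ii-strip»: `Prop39ii_monoAnalyticCompat` instantiated at these strip-level carriers "needs a forgetful
functor `B.Sh ⥤` [carriers with log-volumes]". This file is that junction:

* §1 `prop39ii_monoAnalyticCompat_of_reading` — for ANY category `C`, any set-level READING `U : C ⥤ Type w` and
  object-wise log-volumes `μ X : Set (U X) → ℝ` that are ISO-INVARIANT along `U` (the printed "isomorphisms …
  compatible with … the respective log-volumes" — the defining property of the objects of `Sh`), abc-iut-L6-t4's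
  predicate HOLDS for the reading `{(U e).toEquiv | e ∈ P}` of EVERY poly-isomorphism `P`, with `μD := μ X`,
  `μF := μ Y` (two containers); + monotonicity / composition / transport / symmetry lemmas for the predicate.
* §2 the strip-level instances for `B : BiCoricData S` (every poly-isomorphism of [IUTchIII] §1 listed above).
* §3 the REAL frame `StripFrame.ofKits` (abc-iut-L6-t3 `BiCoricData.ofKits … Bk`, categories `AsSmall`): a
  KIT-level reading `U₀ : Bk.Sh ⥤ Type w` with iso-invariant log-volumes induces the frame-level one
  (`AsSmall.down ⋙ U₀`; abc-iut-w4-d009's `BiCoresOfKitsRealifiedD` pattern), so §2 applies at the real frame with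
  kit-level inputs only.
* §4 the hypothesis GROUNDED at the genuine model BY NAME: a reading valued in locally compact abelian groups
  with integral structures ([AbsTopIII] Prop 5.7 (i); campaign-S `IntegralStructure`) whose isomorphisms read as
  bicontinuous additive isomorphisms carrying integral structure onto integral structure (the shape of the
  isomorphisms of topological modules of Prop 1.2 (vi)–(viii) / Prop 3.2 (i)) IS iso-invariant for
  `μ X := (Λ X).logVolume` (campaign-S Haar uniqueness `IntegralStructure.logVolume_image_equiv`), and likewise for
  the normalised log-volumes `μ^log/d`; hence Prop 3.9 (ii) holds at the strip level for every such reading —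
  no input beyond the reading itself.

HONEST SCOPE. The reading `U`, `μ` is an INPUT (the log-shell algorithms of [AbsTopIII] Prop 5.8 as functors on
L5's kit categories are merge debt of abc-iut-L4-t3 / abc-iut-L6-t2, TODO-merge in `BiCores.lean`); what is
proved is that Prop 3.9 (ii) at the strip level is EXACTLY the iso-invariance of log-volumes on `Sh`, and that
this invariance is a theorem of Haar measure for the genuine containers. typed ≠ endorsed.
-/

noncomputable section

namespace Literature.IUT.LogThetaLattice

open CategoryTheory
open Literature.IUT.HodgeTheaters Literature.IUT.HodgeTheaters.PMBaseKit
open Literature.IUT.LogVolume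

universe w u v u' w'

/-! ### 0. Bookkeeping for abc-iut-L6-t4's predicate: monotonicity, composition, symmetry, transport -/

section Predicate

variable {XD XE XF : Type w}

/-- **IUTchIII:Prop3.9(ii)** (kurims p.116) Monotonicity: compatibility along a poly-isomorphism passes to every
sub-poly-isomorphism (e.g. from the `Ism`-orbit `monoFxm` to the `†F`-level isomorphisms `monoFxmOfF ⊆ monoFxm`,
Prop 1.2 (vi)). [claim: Mochizuki2012, status: disputed] -/
theorem Prop39ii_monoAnalyticCompat.mono {P Q : Set (XD ≃ XF)} {μD : Set XD → ℝ} {μF : Set XF → ℝ}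
    (h : Prop39ii_monoAnalyticCompat Q μD μF) (hPQ : P ⊆ Q) : Prop39ii_monoAnalyticCompat P μD μF :=
  fun e he S => h e (hPQ he) S

/-- **IUTchIII:Prop3.9(ii)** (kurims p.116) Composition: compatibility along `log(†𝒟^⊢) ⥲ log(†𝓕^{⊢×μ})` and along
`log(†𝓕^{⊢×μ}) ⥲ log(†𝓕)` gives compatibility along the composite `log(†𝒟^⊢) ⥲ log(†𝓕)` (Prop 1.2 (viii)).
[claim: Mochizuki2012, status: disputed] -/
theorem Prop39ii_monoAnalyticCompat.comp {P : Set (XD ≃ XE)} {Q : Set (XE ≃ XF)} {μD : Set XD → ℝ}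
    {μE : Set XE → ℝ} {μF : Set XF → ℝ} (hP : Prop39ii_monoAnalyticCompat P μD μE)
    (hQ : Prop39ii_monoAnalyticCompat Q μE μF) :
    Prop39ii_monoAnalyticCompat (Set.image2 (fun e f => e.trans f) P Q) μD μF := by
  rintro _ ⟨e, he, f, hf, rfl⟩ S
  rw [hP e he S, hQ f hf (e '' S), Equiv.coe_trans, Set.image_comp]

/-- **IUTchIII:Prop3.9(ii)** (kurims p.116) Symmetry: compatibility along `P` gives compatibility along the inverse
poly-isomorphism `{e⁻¹}`. [claim: Mochizuki2012, status: disputed] -/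
theorem Prop39ii_monoAnalyticCompat.symm {P : Set (XD ≃ XF)} {μD : Set XD → ℝ} {μF : Set XF → ℝ}
    (h : Prop39ii_monoAnalyticCompat P μD μF) :
    Prop39ii_monoAnalyticCompat (Equiv.symm '' P) μF μD := by
  rintro _ ⟨e, he, rfl⟩ S
  rw [h e he (e.symm '' S), Equiv.image_symm_image]

/-- **IUTchIII:Prop3.9(ii)** (kurims p.116) Transport along identifications of the carriers: if `μD`, `μF` are
compatible along `P`, then their pull-backs along bijections `α : XD' ≃ XD`, `β : XF' ≃ XF` are compatible along the
conjugated poly-isomorphism `{α ≫ e ≫ β⁻¹}`. [claim: Mochizuki2012, status: disputed] -/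
theorem Prop39ii_monoAnalyticCompat.transport {XD' XF' : Type w} {P : Set (XD ≃ XF)} {μD : Set XD → ℝ}
    {μF : Set XF → ℝ} (h : Prop39ii_monoAnalyticCompat P μD μF) (α : XD' ≃ XD) (β : XF' ≃ XF) :
    Prop39ii_monoAnalyticCompat ((fun e => (α.trans e).trans β.symm) '' P) (fun S => μD (α '' S))
      (fun S => μF (β '' S)) := by
  rintro _ ⟨e, he, rfl⟩ S
  change μD (α '' S) = μF (β '' (((α.trans e).trans β.symm) '' S))
  rw [h e he (α '' S), Equiv.coe_trans, Equiv.coe_trans, Set.image_comp, Set.image_comp,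
    Equiv.image_symm_image]

end Predicate

/-! ### 1. Readings of a category with iso-invariant log-volumes -/

section Reading

variable {C : Type u'} [Category.{v} C] (U : C ⥤ Type w) (μ : ∀ X : C, Set (U.obj X) → ℝ)

/-- **IUTchIII:Prop3.9(ii)** (kurims p.116) **The junction schema.** Let `U` be a set-level reading of a category
(`C = Sh`, the collections `{𝓘_v ⊆ log(−)_v}`; [IUTchIII] Prop 1.2 (viii)) with object-wise log-volumes `μ_X` that are
ISO-INVARIANT along `U` — "isomorphisms … compatible with … the respective log-volumes" (Prop 1.2 (vi) p.32).
Then for EVERY poly-isomorphism `P : X ⥲ Y` of `C`, abc-iut-L6-t4's `Prop39ii_monoAnalyticCompat` holds for its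
reading `{(U e).toEquiv | e ∈ P}` with `μD := μ_X`, `μF := μ_Y`: "compatible with the log-volumes … relative to the
natural poly-isomorphisms". [claim: Mochizuki2012, status: disputed] -/
theorem prop39ii_monoAnalyticCompat_of_reading
    (hμ : ∀ {X Y : C} (e : X ≅ Y) (T : Set (U.obj X)), μ X T = μ Y ((U.mapIso e).toEquiv '' T))
    {X Y : C} (P : PolyIso X Y) :
    Prop39ii_monoAnalyticCompat ((fun e : X ≅ Y => (U.mapIso e).toEquiv) '' P) (μ X) (μ Y) := by
  rintro _ ⟨e, -, rfl⟩ T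
  exact hμ e T

/-- **IUTchIII:Prop3.9(ii)** (kurims p.116) The same along a composite reading `G ⋙ U` (e.g. the frame-level reading
of §3, `AsSmall.down ⋙ U₀`): iso-invariance for `U` on `D` gives iso-invariance for `G ⋙ U` on `C`.
[claim: Mochizuki2012, status: disputed] -/
theorem isoInvariant_comp_reading {D : Type*} [Category D] (G : C ⥤ D) (U' : D ⥤ Type w)
    (μ' : ∀ Z : D, Set (U'.obj Z) → ℝ)
    (hμ' : ∀ {Z Z' : D} (e : Z ≅ Z') (T : Set (U'.obj Z)), μ' Z T = μ' Z' ((U'.mapIso e).toEquiv '' T))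
    {X Y : C} (e : X ≅ Y) (T : Set ((G ⋙ U').obj X)) :
    μ' (G.obj X) T = μ' (G.obj Y) (((G ⋙ U').mapIso e).toEquiv '' T) :=
  hμ' (G.mapIso e) T

/-- **IUTchI:§0** (kurims p.33) A reading is functorial on isomorphisms: the reading of a composite is the composite of
the readings. [claim: Mochizuki2012, status: disputed] -/
theorem reading_trans {X Y Z : C} (e : X ≅ Y) (f : Y ≅ Z) :
    (U.mapIso (e ≪≫ f)).toEquiv = (U.mapIso e).toEquiv.trans (U.mapIso f).toEquiv :=
  Equiv.ext fun x => by
    change U.map (e.hom ≫ f.hom) x = U.map f.hom (U.map e.hom x)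
    rw [Functor.map_comp, types_comp_apply]

/-- **IUTchI:§0** (kurims p.33) Readings commute with composition of poly-isomorphisms: the reading of `P ∘ Q` is the
set of composites of readings (so `Prop39ii_monoAnalyticCompat.comp` applies to composite poly-isomorphisms such as
abc-iut-L6-t3's `monoHolAt = monoFxmOfF ∘ fxmHol`). [claim: Mochizuki2012, status: disputed] -/
theorem reading_comp {X Y Z : C} (P : PolyIso X Y) (Q : PolyIso Y Z) :
    (fun e : X ≅ Z => (U.mapIso e).toEquiv) '' P.comp Q =
      Set.image2 (fun e f => e.trans f) ((fun e : X ≅ Y => (U.mapIso e).toEquiv) '' P)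
        ((fun e : Y ≅ Z => (U.mapIso e).toEquiv) '' Q) := by
  ext g
  constructor
  · rintro ⟨h, hh, rfl⟩
    obtain ⟨e, he, f, hf, rfl⟩ := PolyIso.mem_comp.mp hh
    exact Set.mem_image2.mpr ⟨(U.mapIso e).toEquiv, ⟨e, he, rfl⟩, (U.mapIso f).toEquiv, ⟨f, hf, rfl⟩,
      (reading_trans U e f).symm⟩
  · intro hg
    obtain ⟨a, ⟨e, he, rfl⟩, b, ⟨f, hf, rfl⟩, rfl⟩ := Set.mem_image2.mp hg
    exact ⟨e ≪≫ f, PolyIso.mem_comp.mpr ⟨e, he, f, hf, rfl⟩, reading_trans U e f⟩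

/-- **IUTchI:§0** (kurims p.33) The reading of a nonempty poly-isomorphism is nonempty (so the compatibilities
below are never vacuous `∀ e ∈ ∅`: abc-iut-L6-t3's `monoFxm_nonempty`, `monoHolAt_nonempty`,
`monoShellOfDeltaAt_nonempty`). [claim: Mochizuki2012, status: disputed] -/
theorem reading_nonempty {X Y : C} {P : PolyIso X Y} (hP : P.Nonempty) :
    ((fun e : X ≅ Y => (U.mapIso e).toEquiv) '' P).Nonempty :=
  hP.image _

end Reading

/-! ### 2. The strip-level carriers of [IUTchIII] §1 (`BiCoricData`) -/

namespace BiCoricData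

variable {S : StripFrame.{u}} (B : BiCoricData S) (U : B.Sh ⥤ Type w) (μ : ∀ X : B.Sh, Set (U.obj X) → ℝ)
  (hμ : ∀ {X Y : B.Sh} (e : X ≅ Y) (T : Set (U.obj X)), μ X T = μ Y ((U.mapIso e).toEquiv '' T))
include hμ

/-- **IUTchIII:Prop3.9(ii)** (kurims p.116) «similar theory for "`𝓘_{†𝓕^{⊢×μ}_v}`" … compatible with the theory obtained
for "`𝒟^⊢`" relative to the various natural poly-isomorphisms»: compatibility of the mono-analytic log-volume on
`log(†𝒟^⊢)` with the one on `log(†𝓕^{⊢×μ})` along (the reading of) the `Ism`-orbit / `{±1}`-orbit `monoFxm` of Prop 1.2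
(vi)/(vii), at every `𝓕^{⊢×μ}`-prime-strip of the frame. [claim: Mochizuki2012, status: disputed] -/
theorem prop39ii_monoFxm (A : S.Fxm) :
    Prop39ii_monoAnalyticCompat ((fun e => (U.mapIso e).toEquiv) '' B.monoFxm A)
      (μ (B.monoShell.obj (S.FxmToDv.obj A))) (μ (B.fxmShell.obj A)) :=
  prop39ii_monoAnalyticCompat_of_reading U μ hμ (B.monoFxm A)

/-- **IUTchIII:Prop3.9(ii)** (kurims p.116) … along the `†𝓕`-level isomorphisms `monoFxmOfF ⊆ monoFxm` of Prop 1.2 (vi)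
(single at `v ∈ 𝕍^non`). [claim: Mochizuki2012, status: disputed] -/
theorem prop39ii_monoFxmOfF (X : S.F) :
    Prop39ii_monoAnalyticCompat ((fun e => (U.mapIso e).toEquiv) '' B.monoFxmOfF X)
      (μ (B.monoShell.obj (S.FxmToDv.obj (S.toFxm.obj X)))) (μ (B.fxmShell.obj (S.toFxm.obj X))) :=
  prop39ii_monoAnalyticCompat_of_reading U μ hμ (B.monoFxmOfF X)

/-- **IUTchIII:Prop3.9(ii)** (kurims p.116) … along `log(†𝓕^{⊢×μ}) ⥲ log(†𝓕)` (`fxmHol`, Prop 1.2 (vi)/(vii)): compatibility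
of the log-volumes on the `𝓕^{⊢×μ}`-side with "the log-volumes obtained in (i)" on the holomorphic side.
[claim: Mochizuki2012, status: disputed] -/
theorem prop39ii_fxmHol (X : S.F) :
    Prop39ii_monoAnalyticCompat ((fun e => (U.mapIso e).toEquiv) '' B.fxmHol X)
      (μ (B.fxmShell.obj (S.toFxm.obj X))) (μ (B.holShell.obj X)) :=
  prop39ii_monoAnalyticCompat_of_reading U μ hμ (B.fxmHol X)

/-- **IUTchIII:Prop3.9(ii)** (kurims p.116) **R-ii-strip at `monoHolAt`**: the mono-analytic log-volume on
`log(†𝒟^⊢)` (`†𝒟^⊢` computed through `†𝓕^{⊢×μ}`) is compatible with the holomorphic log-volume of (i) on `log(†𝓕)`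
relative to (the reading of) the composite poly-isomorphism `log(†𝒟^⊢) ⥲ log(†𝓕^{⊢×μ}) ⥲ log(†𝓕)` of Prop 1.2 (viii)
(abc-iut-L6-t3's `monoHolAt`), at every `𝓕`-prime-strip of the frame. [claim: Mochizuki2012, status: disputed] -/
theorem prop39ii_monoHolAt (X : S.F) :
    Prop39ii_monoAnalyticCompat ((fun e => (U.mapIso e).toEquiv) '' B.monoHolAt X)
      (μ (B.monoShell.obj (S.FxmToDv.obj (S.toFxm.obj X)))) (μ (B.holShell.obj X)) :=
  prop39ii_monoAnalyticCompat_of_reading U μ hμ (B.monoHolAt X)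

/-- **IUTchIII:Prop3.9(ii)** (kurims p.116) **R-ii-strip at `monoHolAt'`**: the same with `†𝒟^⊢` computed as
`𝒟^⊢(𝒟(†𝓕))` (abc-iut-L6-t3's `monoHolAt'`). [claim: Mochizuki2012, status: disputed] -/
theorem prop39ii_monoHolAt' (X : S.F) :
    Prop39ii_monoAnalyticCompat ((fun e => (U.mapIso e).toEquiv) '' B.monoHolAt' X)
      (μ (B.monoShell.obj (S.DToDv.obj (S.toD.obj X)))) (μ (B.holShell.obj X)) :=
  prop39ii_monoAnalyticCompat_of_reading U μ hμ (B.monoHolAt' X)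

/-- **IUTchIII:Prop3.9(ii)** (kurims p.116) … along the coric isomorphisms `𝓘_{*𝒟^⊢} ⥲ 𝓘_{*𝒟}` of Prop 1.2 (ix)
(`coricIsoAt`), at every `𝒟`-prime-strip. [claim: Mochizuki2012, status: disputed] -/
theorem prop39ii_coricIsoAt (D : S.D) :
    Prop39ii_monoAnalyticCompat ((fun e => (U.mapIso e).toEquiv) '' B.coricIsoAt D)
      (μ (B.monoShell.obj (S.DToDv.obj D))) (μ (B.coricHolShell.obj D)) :=
  prop39ii_monoAnalyticCompat_of_reading U μ hμ (B.coricIsoAt D)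

/-- **IUTchIII:Prop3.9(ii)** (kurims p.116) **R-ii-strip at `monoShellOfDeltaAt`**: the mono-analytic log-volume on
`log(𝒟^⊢_△)` is compatible with the one on `log(𝓕^{⊢×μ}_△(𝒟^⊢_△))` relative to (the reading of) "the natural
poly-isomorphisms `{𝓘_{𝒟^⊢_△}} ⥲ {𝓘_{𝓕^{⊢×μ}_△(𝒟^⊢_△)}}`" of Thm 1.5 (iv) / Prop 1.2 (viii) (abc-iut-L6-t3's
`monoShellOfDeltaAt`), at every `𝒟^⊢`-prime-strip of the frame. [claim: Mochizuki2012, status: disputed] -/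
theorem prop39ii_monoShellOfDeltaAt (Dm : S.Dv) :
    Prop39ii_monoAnalyticCompat ((fun e => (U.mapIso e).toEquiv) '' B.monoShellOfDeltaAt Dm)
      (μ (B.monoShell.obj Dm)) (μ (B.fxmShell.obj (B.fxmOfDv.obj Dm))) :=
  prop39ii_monoAnalyticCompat_of_reading U μ hμ (B.monoShellOfDeltaAt Dm)

/-- **IUTchIII:Prop3.9(ii)** (kurims p.116) … along `{𝓘_{𝒟^⊢_△}} ⥲ {𝓘_{𝓕^{⊢×μ}_△}}` "induced by the Kummer isomorphisms"
(Thm 1.5 (iv), last display; abc-iut-L6-t3's `shellKummerAt`), at every Hodge theater of the frame — the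
log-volume on the Frobenius-like strip agrees with the mono-analytic one. [claim: Mochizuki2012, status: disputed] -/
theorem prop39ii_shellKummerAt (H : S.HT) :
    Prop39ii_monoAnalyticCompat ((fun e => (U.mapIso e).toEquiv) '' B.shellKummerAt H)
      (μ (B.monoShell.obj (B.dvDeltaOf (S.htToD.obj H)))) (μ (B.fxmShell.obj (B.fxmDeltaHT.obj H))) :=
  prop39ii_monoAnalyticCompat_of_reading U μ hμ (B.shellKummerAt H)

/-- **IUTchIII:Prop3.9(ii)** (kurims p.116) … along the bi-coric poly-isomorphisms `{𝓘_{𝒟^⊢_△}} ⥲ {𝓘_{𝒟'^⊢_△}}` of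
Thm 1.5 (iv) (abc-iut-L6-t3's `biCoricShellPolyIso`): the mono-analytic log-volume is an invariant of the
`𝒟^⊢`-prime-strip up to isomorphism ("log-volumes may be constructed via a functorial algorithm from the
`𝒟^⊢`-prime-strips", p.116). [claim: Mochizuki2012, status: disputed] -/
theorem prop39ii_biCoricShellPolyIso (H H' : S.DHT) :
    Prop39ii_monoAnalyticCompat ((fun e => (U.mapIso e).toEquiv) '' B.biCoricShellPolyIso H H')
      (μ (B.monoShell.obj (B.dvDeltaOf H))) (μ (B.monoShell.obj (B.dvDeltaOf H'))) :=
  prop39ii_monoAnalyticCompat_of_reading U μ hμ (B.biCoricShellPolyIso H H')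

omit hμ in
/-- **IUTchIII:Prop1.2(vi)** (kurims p.32) «compatible with one another … and the respective log-volumes»: the
reading of the `†𝓕`-level composite `monoHolAt` is a sub-poly-isomorphism of the reading of the `Ism`-orbit composite
`monoFxm ∘ fxmHol` (abc-iut-L6-t3's `monoHolAt_subset_orbit`), so compatibility along the latter implies it along the
former. [claim: Mochizuki2012, status: disputed] -/
theorem reading_monoHolAt_subset (X : S.F) :
    (fun e => (U.mapIso e).toEquiv) '' B.monoHolAt X ⊆
      (fun e => (U.mapIso e).toEquiv) '' ((B.monoFxm (S.toFxm.obj X)).comp (B.fxmHol X)) :=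
  Set.image_mono (B.monoHolAt_subset_orbit X)

omit hμ in
/-- **IUTchIII:Prop1.2(viii)** (kurims p.33) The readings of `monoHolAt` and `monoShellOfDeltaAt` are NONEMPTY poly-isomorphisms
(abc-iut-L6-t3's `monoHolAt_nonempty`, `monoShellOfDeltaAt_nonempty`), so `prop39ii_monoHolAt` /
`prop39ii_monoShellOfDeltaAt` are not vacuous. [claim: Mochizuki2012, status: disputed] -/
theorem reading_monoHolAt_nonempty (X : S.F) (Dm : S.Dv) :
    ((fun e => (U.mapIso e).toEquiv) '' B.monoHolAt X).Nonempty ∧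
      ((fun e => (U.mapIso e).toEquiv) '' B.monoShellOfDeltaAt Dm).Nonempty :=
  ⟨reading_nonempty U (B.monoHolAt_nonempty X), reading_nonempty U (B.monoShellOfDeltaAt_nonempty Dm)⟩

end BiCoricData

/-! ### 3. The real frame `StripFrame.ofKits`: kit-level readings -/

section OfKits

variable {l : ℕ} {K : PMBaseKit.{u} l} {M : K.MultKit} {FK : K.FKit M}
  (L : FK.MonoLaws) (hbij : FK.IsomFtoDBijective) (hsurj : FK.IsomFmtoDmSurjective) (hR : FK.RlfOfIsStrip)
  (X : TimesMuSide FK L) (Bk : BiCoricKit X)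
  (U₀ : Bk.Sh ⥤ Type w) (μ₀ : ∀ Z : Bk.Sh, Set (U₀.obj Z) → ℝ)
  (hμ₀ : ∀ {Z Z' : Bk.Sh} (e : Z ≅ Z') (T : Set (U₀.obj Z)), μ₀ Z T = μ₀ Z' ((U₀.mapIso e).toEquiv '' T))
include hμ₀

/-- **IUTchIII:Prop3.9(ii)** (kurims p.116) At the REAL frame: a KIT-level reading `U₀` of `Bk.Sh` with iso-invariant
log-volumes induces the frame-level reading `AsSmall.down ⋙ U₀` of `(BiCoricData.ofKits … Bk).Sh = AsSmall Bk.Sh`, again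
with iso-invariant log-volumes. [claim: Mochizuki2012, status: disputed] -/
theorem isoInvariant_ofKits_reading
    {A A' : (BiCoricData.ofKits L hbij hsurj hR X Bk).Sh} (e : A ≅ A')
    (T : Set ((AsSmall.down ⋙ U₀).obj A)) :
    μ₀ (AsSmall.down.obj A) T = μ₀ (AsSmall.down.obj A') (((AsSmall.down ⋙ U₀).mapIso e).toEquiv '' T) :=
  isoInvariant_comp_reading AsSmall.down U₀ μ₀ (fun e T => hμ₀ e T) e T

/-- **IUTchIII:Prop3.9(ii)** (kurims p.116) **R-ii-strip at the real frame, `monoHolAt`**: for the bi-coric data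
`BiCoricData.ofKits … Bk` over `StripFrame.ofKits` (abc-iut-L6-t3) and ANY kit-level reading of the log-shell category
with iso-invariant log-volumes, Prop 3.9 (ii) holds along the Prop 1.2 (viii) composite at every `𝓕`-prime-strip of
the real frame. [claim: Mochizuki2012, status: disputed] -/
theorem prop39ii_ofKits_monoHolAt (F : (StripFrame.ofKits L hbij hsurj hR X).F) :
    Prop39ii_monoAnalyticCompat
      ((fun e => ((AsSmall.down ⋙ U₀).mapIso e).toEquiv) '' (BiCoricData.ofKits L hbij hsurj hR X Bk).monoHolAt F)
      (μ₀ (AsSmall.down.obj ((BiCoricData.ofKits L hbij hsurj hR X Bk).monoShell.obj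
        ((StripFrame.ofKits L hbij hsurj hR X).FxmToDv.obj ((StripFrame.ofKits L hbij hsurj hR X).toFxm.obj F)))))
      (μ₀ (AsSmall.down.obj ((BiCoricData.ofKits L hbij hsurj hR X Bk).holShell.obj F))) :=
  (BiCoricData.ofKits L hbij hsurj hR X Bk).prop39ii_monoHolAt (AsSmall.down ⋙ U₀)
    (fun A => μ₀ (AsSmall.down.obj A))
    (fun e T => isoInvariant_ofKits_reading L hbij hsurj hR X Bk U₀ μ₀ hμ₀ e T) F

/-- **IUTchIII:Prop3.9(ii)** (kurims p.116) **R-ii-strip at the real frame, `monoShellOfDeltaAt`**: likewise along the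
Thm 1.5 (iv) poly-isomorphism `{𝓘_{𝒟^⊢_△}} ⥲ {𝓘_{𝓕^{⊢×μ}_△(𝒟^⊢_△)}}` at every `𝒟^⊢`-prime-strip of the real frame.
[claim: Mochizuki2012, status: disputed] -/
theorem prop39ii_ofKits_monoShellOfDeltaAt (Dm : (StripFrame.ofKits L hbij hsurj hR X).Dv) :
    Prop39ii_monoAnalyticCompat
      ((fun e => ((AsSmall.down ⋙ U₀).mapIso e).toEquiv) ''
        (BiCoricData.ofKits L hbij hsurj hR X Bk).monoShellOfDeltaAt Dm)
      (μ₀ (AsSmall.down.obj ((BiCoricData.ofKits L hbij hsurj hR X Bk).monoShell.obj Dm)))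
      (μ₀ (AsSmall.down.obj ((BiCoricData.ofKits L hbij hsurj hR X Bk).fxmShell.obj
        ((BiCoricData.ofKits L hbij hsurj hR X Bk).fxmOfDv.obj Dm)))) :=
  (BiCoricData.ofKits L hbij hsurj hR X Bk).prop39ii_monoShellOfDeltaAt (AsSmall.down ⋙ U₀)
    (fun A => μ₀ (AsSmall.down.obj A))
    (fun e T => isoInvariant_ofKits_reading L hbij hsurj hR X Bk U₀ μ₀ hμ₀ e T) Dm

/-- **IUTchIII:Prop3.9(ii)** (kurims p.116) **R-ii-strip at the real frame, `monoFxm`**: likewise along the `Ism`-orbit of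
Prop 1.2 (vi)/(vii) at every `𝓕^{⊢×μ}`-prime-strip of the real frame (membership read at kit level through
abc-iut-L6-t3's `BiCoricData.ofKits_mem_monoFxm_iff`). [claim: Mochizuki2012, status: disputed] -/
theorem prop39ii_ofKits_monoFxm (A : (StripFrame.ofKits L hbij hsurj hR X).Fxm) :
    Prop39ii_monoAnalyticCompat
      ((fun e => ((AsSmall.down ⋙ U₀).mapIso e).toEquiv) '' (BiCoricData.ofKits L hbij hsurj hR X Bk).monoFxm A)
      (μ₀ (AsSmall.down.obj ((BiCoricData.ofKits L hbij hsurj hR X Bk).monoShell.obj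
        ((StripFrame.ofKits L hbij hsurj hR X).FxmToDv.obj A))))
      (μ₀ (AsSmall.down.obj ((BiCoricData.ofKits L hbij hsurj hR X Bk).fxmShell.obj A))) :=
  (BiCoricData.ofKits L hbij hsurj hR X Bk).prop39ii_monoFxm (AsSmall.down ⋙ U₀)
    (fun A => μ₀ (AsSmall.down.obj A))
    (fun e T => isoInvariant_ofKits_reading L hbij hsurj hR X Bk U₀ μ₀ hμ₀ e T) A

end OfKits

/-! ### 4. The hypothesis at the genuine model: readings valued in containers with integral structures -/

section Genuine

variable {C : Type u'} [Category.{v} C] (U : C ⥤ Type w)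
  [∀ X : C, AddCommGroup (U.obj X)] [∀ X : C, TopologicalSpace (U.obj X)]
  [∀ X : C, IsTopologicalAddGroup (U.obj X)] [∀ X : C, MeasurableSpace (U.obj X)]
  [∀ X : C, BorelSpace (U.obj X)] (Λ : ∀ X : C, IntegralStructure (U.obj X))
  (hU : ∀ {X Y : C} (e : X ≅ Y), ∃ φ : U.obj X ≃ₜ+ U.obj Y,
    (⇑φ : U.obj X → U.obj Y) = (U.mapIso e).hom ∧ φ '' (Λ X : Set (U.obj X)) = (Λ Y : Set (U.obj Y)))
include hU

/-- **IUTchIII:Prop3.9(ii)** (kurims p.116) **The iso-invariance hypothesis IS a theorem of Haar measure for genuine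
containers.** If the reading `U` of the log-shell category lands in locally compact abelian groups `U X` carrying
integral structures `Λ_X` ("the 'mono-analytic' integral structures of Proposition 3.2, (ii)"; [AbsTopIII] Prop 5.7
(i)) and every isomorphism reads as a bicontinuous additive isomorphism carrying `Λ_X` onto `Λ_Y` (isomorphisms of
topological modules respecting log-shells, Prop 1.2 (vi)–(viii)), then the `Λ`-normalised log-volumes
`μ_X := μ^log_{Λ_X}` are iso-invariant along `U` (campaign-S `IntegralStructure.logVolume_image_equiv`, Haar uniqueness).
[claim: Mochizuki2012, status: disputed] -/
theorem isoInvariant_logVolume_of_integralStructures {X Y : C} (e : X ≅ Y) (T : Set (U.obj X)) :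
    (Λ X).logVolume T = (Λ Y).logVolume ((U.mapIso e).toEquiv '' T) := by
  obtain ⟨φ, hφ, hΛ⟩ := hU e
  have hcoe : ((U.mapIso e).toEquiv : U.obj X → U.obj Y) = (⇑φ : U.obj X → U.obj Y) := by
    rw [hφ]; rfl
  rw [hcoe]
  exact ((Λ X).logVolume_image_equiv (Λ Y) φ hΛ T).symm

/-- **IUTchIII:Prop3.9(ii)** (kurims p.116) The same for the NORMALISED log-volumes `μ^log/d` (common weight `d`, e.g. the
`ℚ_{p_{v_ℚ}}`-dimension; Rmk 3.1.1 (ii)). [claim: Mochizuki2012, status: disputed] -/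
theorem isoInvariant_normalizedLogVolume_of_integralStructures (d : ℕ) {X Y : C} (e : X ≅ Y)
    (T : Set (U.obj X)) :
    (Λ X).normalizedLogVolume d T = (Λ Y).normalizedLogVolume d ((U.mapIso e).toEquiv '' T) := by
  obtain ⟨φ, hφ, hΛ⟩ := hU e
  have hcoe : ((U.mapIso e).toEquiv : U.obj X → U.obj Y) = (⇑φ : U.obj X → U.obj Y) := by
    rw [hφ]; rfl
  rw [hcoe]
  exact ((Λ X).normalizedLogVolume_image_equiv (Λ Y) d φ hΛ T).symm

/-- **IUTchIII:Prop3.9(ii)** (kurims p.116) **Prop 3.9 (ii) along EVERY poly-isomorphism of a category read in genuine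
containers**: for such a reading, abc-iut-L6-t4's `Prop39ii_monoAnalyticCompat` holds for the reading of every
poly-isomorphism with the `Λ`-normalised log-volumes on both sides — no input beyond the reading (§1 ∘ Haar
uniqueness; the two-container form of abc-iut-L6-d3/L6-t4's `prop39ii_monoAnalyticCompat_integralStructure`).
[claim: Mochizuki2012, status: disputed] -/
theorem prop39ii_monoAnalyticCompat_of_integralStructures {X Y : C} (P : PolyIso X Y) :
    Prop39ii_monoAnalyticCompat ((fun e : X ≅ Y => (U.mapIso e).toEquiv) '' P) (Λ X).logVolume (Λ Y).logVolume :=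
  prop39ii_monoAnalyticCompat_of_reading U (fun X => (Λ X).logVolume)
    (fun e T => isoInvariant_logVolume_of_integralStructures U Λ hU e T) P

end Genuine

section GenuineStrip

/-- **IUTchIII:Prop3.9(ii)** (kurims p.116) **R-ii-strip, genuine form**: for a `B : BiCoricData S` whose log-shell category
`Sh` is read in genuine containers with integral structures as above, the mono-analytic log-volume
`μ^log_{Λ(log †𝒟^⊢)}` and the holomorphic log-volume `μ^log_{Λ(log †𝓕)}` are compatible along the Prop 1.2 (viii)
poly-isomorphism `log(†𝒟^⊢) ⥲ log(†𝓕^{⊢×μ}) ⥲ log(†𝓕)` (`monoHolAt`) at every `𝓕`-prime-strip — and (same proof, `P :=` any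
of the §2 carriers) along `monoFxm`, `monoShellOfDeltaAt`, `shellKummerAt`, `biCoricShellPolyIso`.
[claim: Mochizuki2012, status: disputed] -/
theorem BiCoricData.prop39ii_monoHolAt_of_integralStructures {S : StripFrame.{u}} (B : BiCoricData S)
    (U : B.Sh ⥤ Type w)
    [∀ X : B.Sh, AddCommGroup (U.obj X)] [∀ X : B.Sh, TopologicalSpace (U.obj X)]
    [∀ X : B.Sh, IsTopologicalAddGroup (U.obj X)] [∀ X : B.Sh, MeasurableSpace (U.obj X)]
    [∀ X : B.Sh, BorelSpace (U.obj X)] (Λ : ∀ X : B.Sh, IntegralStructure (U.obj X))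
    (hU : ∀ {X Y : B.Sh} (e : X ≅ Y), ∃ φ : U.obj X ≃ₜ+ U.obj Y,
      (⇑φ : U.obj X → U.obj Y) = (U.mapIso e).hom ∧ φ '' (Λ X : Set (U.obj X)) = (Λ Y : Set (U.obj Y)))
    (X : S.F) :
    Prop39ii_monoAnalyticCompat ((fun e => (U.mapIso e).toEquiv) '' B.monoHolAt X)
      (Λ (B.monoShell.obj (S.FxmToDv.obj (S.toFxm.obj X)))).logVolume (Λ (B.holShell.obj X)).logVolume :=
  prop39ii_monoAnalyticCompat_of_integralStructures U Λ hU (B.monoHolAt X)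

/-- **IUTchIII:Prop3.9(ii)** (kurims p.116) … and along the Thm 1.5 (iv) poly-isomorphism at every `𝒟^⊢`-prime-strip
(`monoShellOfDeltaAt`), genuine form. [claim: Mochizuki2012, status: disputed] -/
theorem BiCoricData.prop39ii_monoShellOfDeltaAt_of_integralStructures {S : StripFrame.{u}} (B : BiCoricData S)
    (U : B.Sh ⥤ Type w)
    [∀ X : B.Sh, AddCommGroup (U.obj X)] [∀ X : B.Sh, TopologicalSpace (U.obj X)]
    [∀ X : B.Sh, IsTopologicalAddGroup (U.obj X)] [∀ X : B.Sh, MeasurableSpace (U.obj X)]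
    [∀ X : B.Sh, BorelSpace (U.obj X)] (Λ : ∀ X : B.Sh, IntegralStructure (U.obj X))
    (hU : ∀ {X Y : B.Sh} (e : X ≅ Y), ∃ φ : U.obj X ≃ₜ+ U.obj Y,
      (⇑φ : U.obj X → U.obj Y) = (U.mapIso e).hom ∧ φ '' (Λ X : Set (U.obj X)) = (Λ Y : Set (U.obj Y)))
    (Dm : S.Dv) :
    Prop39ii_monoAnalyticCompat ((fun e => (U.mapIso e).toEquiv) '' B.monoShellOfDeltaAt Dm)
      (Λ (B.monoShell.obj Dm)).logVolume (Λ (B.fxmShell.obj (B.fxmOfDv.obj Dm))).logVolume :=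
  prop39ii_monoAnalyticCompat_of_integralStructures U Λ hU (B.monoShellOfDeltaAt Dm)

end GenuineStrip

end Literature.IUT.LogThetaLattice

end
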